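import Literature.NumberTheory.GaloisRepresentations.AdZeroBlochKatoDatum
import Literature.NumberTheory.GaloisRepresentations.ResidualRepOfTraceCongruence
import Literature.NumberTheory.GaloisRepresentations.ResidualGaloisRepOpenKernel
import HarnessLib

/-!
# Helpers for stub S1 (`stub_residualAdjointForm`) of crux `AdjointLiftingGL3`, line `birth`, I:
# the fixed frame `Ad⁰ : GL₂ → GL₃`, its twist `χ · Ad⁰ ρ`, integral models and reductions

Crux `stmt-Langlands-16779` = `Summit.Langlands.Langlands.Theses.RamifiedCoefficientSeed.AdjointLiftingGL3`
(line `birth`, skeleton v4).  General lemmas (no reference to the crux's `ρ`; theorems only, no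
definition), all PROVED, used by the sibling file
`RamifiedCoefficientSeedAdjointLiftingGL3StubResidualAdjointForm.lean` (the residual dictionary
`τ ≅ η̄ ⊗ ad⁰ τ₀`).  The twisted frame is the accepted `FramedRep.adZeroTwoTwistMatrix ρ χ`
(`g ↦ χ(g) · Ad⁰(ρ g) ∈ M₃(R)`, file `AdZeroBlochKatoDatum`) made `GL₃`-valued by Mathlib's
`MonoidHom.toHomUnits`; for the crux, `χ = det ∘ η = η₀₀` for a `GL₁`-valued `η`.

* `glAdZeroTwoFrame_map` — the accepted frame `glAdZeroTwoFrame R : GL₂(R) →* GL₃(R)` of `Ad⁰`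
  (explicit matrix `coe_glAdZeroTwoFrame_apply`) is natural in the ring `R` (its entries are
  polynomials in the entries of `P` and `P⁻¹`); `trace_glAdZeroTwoFrame` —
  `tr Ad⁰(P) = tr(P)² / det P − 1` over a field; `trace_adZeroTwoTwist` — hence
  `tr (χ · Ad⁰ ρ)(g) = χ(g) (tr ρ(g)² / det ρ(g) − 1)`, the adjoint expression of the crux's seed
  congruence `AdjointSeed` (with `χ = η₀₀`).
* `map_twist_apply`, `twist_apply_of_conj` — naturality and conjugation equivariance of the
  twisted frame, whence **`isIntegralModelOf_adZeroTwoTwist`** (the registered sub-goal of this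
  file): `det ηᴵ · Ad⁰ ρᴵ` is an integral model of `det η · Ad⁰ ρ` whenever `ρᴵ`, `ηᴵ` are integral
  models of `ρ`, `η` (`IsIntegralModelOf` of `ResidualGaloisRep`); and
  `coe_integralReduction_adZeroTwoTwist`: its reduction is `η̄(g)₀₀ · Ad⁰(ρ̄ g)` on the nose.
* `finite_range_of_isReductionOf` — a reduction of a continuous `ρ : Γ_K → GL_n(ℚ̄_ℓ)` has
  finite image (open kernel, `isOpen_ker_of_isReductionOf`; `Γ_K` compact).

## References

* [DarmonDiamondTaylor1995] H. Darmon, F. Diamond, R. Taylor, *Fermat's Last Theorem* (1995), §2.1,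
  p. 54 (integral models, reductions).
* [SerreAbelianLadic1968] J.-P. Serre, *Abelian ℓ-adic representations and elliptic curves* (1968),
  Ch. I §1.1.
* [DeligneSerreASENS1974] P. Deligne, J.-P. Serre, *Formes modulaires de poids 1*, 6.12.
* [ACCGHLNSTT2023] P. B. Allen et al., *Potential automorphy over CM fields*, Def. 6.2.28 (`ad⁰`).
-/

set_option linter.dupNamespace false

noncomputable section

namespace Summit.Langlands.Langlands.Cruxes.AdjointLiftingGL3.Birth

open scoped MatrixGroups NumberField Matrix
open NumberField IsDedekindDomain Field Filter
open Literature.NumberTheory.GaloisRepresentations Literature.NumberTheory.PAdicHodge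
open Literature.NumberTheory.Automorphic

universe u v w

/-! ## §1. The fixed frame `Ad⁰ : GL₂(R) →* GL₃(R)`: naturality and trace -/

section Frame

variable {R : Type u} [CommRing R] {S : Type v} [CommRing S]

/-- **The frame `Ad⁰` is natural in the ring**: `Ad⁰(GL₂(f) P) = GL₃(f) (Ad⁰ P)` for a ring
homomorphism `f : R → S` (the entries of `Ad⁰(P)` are polynomials in the entries of `P` and `P⁻¹`,
`coe_glAdZeroTwoFrame_apply`). [folklore] -/
theorem glAdZeroTwoFrame_map (f : R →+* S) (P : GL (Fin 2) R) :
    glAdZeroTwoFrame S (Matrix.GeneralLinearGroup.map f P) =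
      Matrix.GeneralLinearGroup.map f (glAdZeroTwoFrame R P) := by
  refine Units.ext ?_
  rw [coe_glAdZeroTwoFrame_apply, ← map_inv]
  change adZeroTwoMatrixOf S ((P : Matrix (Fin 2) (Fin 2) R).map f)
      (((P⁻¹ : GL (Fin 2) R) : Matrix (Fin 2) (Fin 2) R).map f) =
    (((glAdZeroTwoFrame R P : GL (Fin 3) R) : Matrix (Fin 3) (Fin 3) R)).map f
  rw [coe_glAdZeroTwoFrame_apply]
  ext i j
  fin_cases i <;> fin_cases j <;> simp [adZeroTwoMatrixOf, Matrix.map_apply, map_sub, map_mul]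

/-- **`tr Ad⁰(P) = tr(P)² / det P − 1`** for `P ∈ GL₂(F)`, `F` a field (the eigenvalues of `Ad⁰(P)`
are `1, α/β, β/α`). [folklore] -/
theorem trace_glAdZeroTwoFrame {F : Type u} [Field F] (P : GL (Fin 2) F) :
    ((glAdZeroTwoFrame F P : GL (Fin 3) F) : Matrix (Fin 3) (Fin 3) F).trace =
      (P : Matrix (Fin 2) (Fin 2) F).trace ^ 2 * ((P : Matrix (Fin 2) (Fin 2) F).det)⁻¹ - 1 := by
  have hdet : (P : Matrix (Fin 2) (Fin 2) F).det ≠ 0 := P.det_ne_zero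
  rw [coe_glAdZeroTwoFrame_apply, coe_inv_eq_smul_fin_two, Units.smul_def, Units.val_inv_eq_inv_val,
    Matrix.GeneralLinearGroup.val_det_apply, Matrix.trace_fin_three, Matrix.trace_fin_two]
  rw [Matrix.det_fin_two] at hdet ⊢
  simp [adZeroTwoMatrixOf]
  field_simp
  ring

/-! ## §2. The twisted frame `g ↦ χ(g) · Ad⁰(ρ g)` (bare homomorphisms) -/

variable {G : Type w} [Group G]

/-- Unfolding lemma: the matrix of the `GL₃`-valued twisted frame
`(FramedRep.adZeroTwoTwistMatrix ρ χ).toHomUnits` at `g` is `χ(g) · Ad⁰(ρ g)`. [folklore] -/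
theorem coe_twist_apply (ρ : G →* GL (Fin 2) R) (χ : G →* Rˣ) (g : G) :
    (((FramedRep.adZeroTwoTwistMatrix ρ χ).toHomUnits g : GL (Fin 3) R) : Matrix (Fin 3) (Fin 3) R) =
      ((χ g : Rˣ) : R) • ((glAdZeroTwoFrame R (ρ g) : GL (Fin 3) R) : Matrix (Fin 3) (Fin 3) R) :=
  rfl

/-- For `χ = det ∘ η`, `η : G → GL₁(R)`: the matrix of the twisted frame is `η(g)₀₀ · Ad⁰(ρ g)`
(`det` of a `1 × 1` matrix is its entry). [folklore] -/
theorem coe_twist_det_apply (ρ : G →* GL (Fin 2) R) (η : G →* GL (Fin 1) R) (g : G) :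
    (((FramedRep.adZeroTwoTwistMatrix ρ (Matrix.GeneralLinearGroup.det.comp η)).toHomUnits g :
        GL (Fin 3) R) : Matrix (Fin 3) (Fin 3) R) =
      (((η g : GL (Fin 1) R) : Matrix (Fin 1) (Fin 1) R) 0 0) •
        (((glAdZeroTwoFrame R).comp ρ g : GL (Fin 3) R) : Matrix (Fin 3) (Fin 3) R) := by
  rw [coe_twist_apply, MonoidHom.comp_apply, Matrix.GeneralLinearGroup.val_det_apply,
    Matrix.det_fin_one]
  rfl

/-- **Naturality of the twisted frame**: `GL₃(f) (χ(g) · Ad⁰(ρ g)) = f(χ(g)) · Ad⁰((fρ) g)`.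
[folklore] -/
theorem map_twist_apply (f : R →+* S) (ρ : G →* GL (Fin 2) R) (χ : G →* Rˣ) (g : G) :
    Matrix.GeneralLinearGroup.map f ((FramedRep.adZeroTwoTwistMatrix ρ χ).toHomUnits g) =
      (FramedRep.adZeroTwoTwistMatrix ((Matrix.GeneralLinearGroup.map f).comp ρ)
        ((Units.map (f : R →* S)).comp χ)).toHomUnits g := by
  refine Units.ext ?_
  rw [coe_twist_apply, MonoidHom.comp_apply, MonoidHom.comp_apply, glAdZeroTwoFrame_map,
    Units.coe_map, MonoidHom.coe_coe]
  exact Matrix.map_smul' f _ _ (map_mul f)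

/-- `det ∘ GL₁(f) ∘ η = f ∘ det ∘ η` (Mathlib `Matrix.GeneralLinearGroup.map_det`). [folklore] -/
theorem det_comp_map_comp (f : R →+* S) (η : G →* GL (Fin 1) R) :
    Matrix.GeneralLinearGroup.det.comp ((Matrix.GeneralLinearGroup.map f).comp η) =
      (Units.map (f : R →* S)).comp (Matrix.GeneralLinearGroup.det.comp η) :=
  MonoidHom.ext fun g => Matrix.GeneralLinearGroup.map_det f (η g)

/-- **Conjugation equivariance of the twisted frame**: if `ρ' = Q⁻¹ ρ Q` and `χ' = χ` pointwise,
then `χ'(g) · Ad⁰(ρ' g) = Ad⁰(Q)⁻¹ (χ(g) · Ad⁰(ρ g)) Ad⁰(Q)`. [folklore] -/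
theorem twist_apply_of_conj {ρ ρ' : G →* GL (Fin 2) R} {χ χ' : G →* Rˣ} (Q : GL (Fin 2) R)
    (hρ : ∀ g, ρ' g = Q⁻¹ * ρ g * Q) (hχ : ∀ g, χ' g = χ g) (g : G) :
    (FramedRep.adZeroTwoTwistMatrix ρ' χ').toHomUnits g =
      (glAdZeroTwoFrame R Q)⁻¹ * (FramedRep.adZeroTwoTwistMatrix ρ χ).toHomUnits g *
        glAdZeroTwoFrame R Q := by
  refine Units.ext ?_
  rw [Units.val_mul, Units.val_mul, coe_twist_apply, coe_twist_apply, hρ g, hχ g, map_mul, map_mul,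
    map_inv, Units.val_mul, Units.val_mul, Matrix.mul_smul, Matrix.smul_mul]

/-- The determinant character of a conjugate is unchanged: `det (U⁻¹ η U) = det η`. [folklore] -/
theorem det_conj_eq {η η' : G →* GL (Fin 1) R} (U : GL (Fin 1) R) (hη : ∀ g, η' g = U⁻¹ * η g * U)
    (g : G) :
    Matrix.GeneralLinearGroup.det.comp η' g = Matrix.GeneralLinearGroup.det.comp η g := by
  rw [MonoidHom.comp_apply, MonoidHom.comp_apply, hη g, map_mul, map_mul, map_inv,
    inv_mul_cancel_comm]

/-- **Integral models of the twisted frame** (the registered sub-goal of this file): if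
`ρᴵ : G → GL₂(O)` and `ηᴵ : G → GL₁(O)` are integral models of `ρ`, `η` over a valuation subring
`O ⊆ F` (`ρᴵ = Q⁻¹ ρ Q`, `ηᴵ = U⁻¹ η U` in `GL(F)`, `IsIntegralModelOf`), then
`det ηᴵ · Ad⁰ ρᴵ : G → GL₃(O)` is an integral model of `det η · Ad⁰ ρ` (conjugate by `Ad⁰(Q)`; the
frame is natural along `O ⊆ F` and `det` is conjugation invariant).  With `O = ℤ̄_p` this is the
`G`-stable lattice `ad⁰_O ⊗ η` of `η ⊗ ad⁰ ρ` used to reduce the seed congruence.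
[cite: DarmonDiamondTaylor1995, §2.1, p. 54] -/
theorem isIntegralModelOf_adZeroTwoTwist :
    ∀ {F : Type*} [Field F] {O : ValuationSubring F} {G : Type*} [Group G]
      {ρ : G →* GL (Fin 2) F} {η : G →* GL (Fin 1) F} {ρI : G →* GL (Fin 2) O}
      {ηI : G →* GL (Fin 1) O}, IsIntegralModelOf ρ ρI → IsIntegralModelOf η ηI →
        IsIntegralModelOf
          (FramedRep.adZeroTwoTwistMatrix ρ (Matrix.GeneralLinearGroup.det.comp η)).toHomUnits
          (FramedRep.adZeroTwoTwistMatrix ρI (Matrix.GeneralLinearGroup.det.comp ηI)).toHomUnits := by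
  intro F _ O G _ ρ η ρI ηI hρ hη
  obtain ⟨Q, hQ⟩ := hρ
  obtain ⟨U, hU⟩ := hη
  refine ⟨glAdZeroTwoFrame F Q, fun g => ?_⟩
  rw [map_twist_apply, ← det_comp_map_comp]
  exact twist_apply_of_conj Q (fun g => hQ g) (det_conj_eq U (fun g => hU g)) g

/-- **The reduction of the twisted frame is the twisted frame of the reductions**, on the nose:
`(det ηᴵ · Ad⁰ ρᴵ mod 𝔪)(g) = η̄(g)₀₀ · Ad⁰(ρ̄ g)` with `ρ̄ = ρᴵ mod 𝔪`, `η̄ = ηᴵ mod 𝔪`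
(`integralReduction`, pushed along `ι`). [folklore] -/
theorem coe_integralReduction_adZeroTwoTwist {F : Type*} [Field F] {O : ValuationSubring F}
    {k : Type*} [Field k] (ι : IsLocalRing.ResidueField O →+* k) (ρI : G →* GL (Fin 2) O)
    (ηI : G →* GL (Fin 1) O) (g : G) :
    ((integralReduction ι
        (FramedRep.adZeroTwoTwistMatrix ρI (Matrix.GeneralLinearGroup.det.comp ηI)).toHomUnits g :
        GL (Fin 3) k) : Matrix (Fin 3) (Fin 3) k) =
      (((integralReduction ι ηI g : GL (Fin 1) k) : Matrix (Fin 1) (Fin 1) k) 0 0) •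
        (((glAdZeroTwoFrame k).comp (integralReduction ι ρI) g : GL (Fin 3) k) :
          Matrix (Fin 3) (Fin 3) k) := by
  change ((Matrix.GeneralLinearGroup.map (ι.comp (IsLocalRing.residue O))
    ((FramedRep.adZeroTwoTwistMatrix ρI (Matrix.GeneralLinearGroup.det.comp ηI)).toHomUnits g) :
    GL (Fin 3) k) : Matrix (Fin 3) (Fin 3) k) = _
  rw [map_twist_apply, ← det_comp_map_comp, coe_twist_det_apply]
  rfl

end Frame

/-! ## §3. The trace of the continuous twisted frame -/

section Continuous

variable {G : Type w} [Group G] [TopologicalSpace G]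

/-- **`tr (χ · Ad⁰ ρ)(g) = χ(g) · (tr ρ(g)² / det ρ(g) − 1)`** for the accepted continuous twisted
frame `FramedRep.adZeroTwoTwist ρ χ` over a topological field — with `χ = η₀₀` the adjoint
expression of the seed congruence `AdjointSeed` of the crux (`tr ad⁰ = tr²/det − 1`). [folklore] -/
theorem trace_adZeroTwoTwist {F : Type u} [Field F] [TopologicalSpace F] [IsTopologicalRing F]
    (ρ : G →ₜ* GL (Fin 2) F) (χ : G →ₜ* Fˣ) (g : G) :
    ((FramedRep.adZeroTwoTwist ρ χ g : GL (Fin 3) F) : Matrix (Fin 3) (Fin 3) F).trace =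
      ((χ g : Fˣ) : F) *
        ((((ρ g : GL (Fin 2) F) : Matrix (Fin 2) (Fin 2) F).trace) ^ 2 *
          (((ρ g : GL (Fin 2) F) : Matrix (Fin 2) (Fin 2) F).det)⁻¹ - 1) := by
  rw [FramedRep.coe_adZeroTwoTwist_apply, Matrix.trace_smul, trace_glAdZeroTwoFrame, smul_eq_mul]

end Continuous

/-! ## §4. Reductions of continuous `ℚ̄_ℓ`-representations have finite image -/

section Finite

/-- **A reduction of a continuous `ρ : Γ_K → GL_n(ℚ̄_ℓ)` has finite image** (`char K = 0`): its
kernel is open (`isOpen_ker_of_isReductionOf`, Deligne–Serre 6.12) in the compact group `Γ_K`.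
[cite: DeligneSerreASENS1974, 6.12] -/
theorem finite_range_of_isReductionOf {K : Type u} [Field K] [CharZero K] {ℓ : ℕ} [Fact ℓ.Prime]
    {n : ℕ} {ρ : FramedGaloisRep K (PadicAlgCl ℓ) n} {k : Type w} [Field k]
    {ι : padicAlgClResidueField ℓ →+* k} {τ : absoluteGaloisGroup K →* GL (Fin n) k}
    (h : ρ.IsReductionOf ι τ) : (Set.range τ).Finite := by
  have hopen : IsOpen (τ.ker : Set (absoluteGaloisGroup K)) :=
    FramedGaloisRep.isOpen_ker_of_isReductionOf h
  haveI : Finite (absoluteGaloisGroup K ⧸ τ.ker) := Subgroup.quotient_finite_of_isOpen _ hopen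
  haveI : Finite τ.range := Finite.of_equiv _ (QuotientGroup.quotientKerEquivRange τ).toEquiv
  rw [← MonoidHom.coe_range]
  exact Set.toFinite _

end Finite

end Summit.Langlands.Langlands.Cruxes.AdjointLiftingGL3.Birth

end
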